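import Literature.Computability.QuantumComplexity.StateVectorDP
import Literature.Computability.Complexity.ZIntBricks
import Literature.Computability.Complexity.ListFoldBricks
import HarnessLib

/-!
# `ℤ[ω]` amplitudes in the `FP` string algebra: codes and exact arithmetic bricks

Topic `Literature/Computability/QuantumComplexity`, machine layer under `StateVectorDP.lean`
(`ZW = Fin 4 → ℤ`, `zwVal`, `mulOmega`, `mulOmegaPow`, `zwU`, `zwV`, `posSqrtTwoTest`: the exact
state-vector DP of Clifford+`T` circuits over `ℤ[ω]`, `ω = e^{iπ/4}`), written in the brick algebra
of `BrickAlgebra.lean` / `ZIntBricks.lean` (integers as canonical difference pairs `dpEnc z`,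
total value `ival`, `zaddF`, `zsubF`, `zmulF`, `znegF`, `zleF`, `iposFn`). An amplitude
`a₀ + a₁ω + a₂ω² + a₃ω³` is the four-field record `⟨dpEnc a₀, ⟨dpEnc a₁, ⟨dpEnc a₂, dpEnc a₃⟩⟩⟩`;
every brick is a TOTAL string function with a closed-form value through the total decoder
`ZWCode.dec` (so machine specifications are equations on all strings):

* `ZWCode.enc`, `ZWCode.dec` (`dec (enc a) = a`), `zwCanonF u = enc (dec u)`;
* `zwAddF ⟨u, v⟩ = enc (dec u + dec v)`, `mulOmegaF u = enc (mulOmega (dec u))`,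
  `zwPowF j u = enc (mulOmegaPow j (dec u))`, and the phase dispatch
  `zwRotF ⟨1^k, u⟩ = enc (mulOmegaPow k (dec u))` for `k < 8` (an `iteFn` chain on the unary phase);
* the norm parts `zwUF u = dpEnc (zwU (dec u))`, `zwVF u = dpEnc (zwV (dec u))`;
* the one-bit sign test `posTestF ⟨a, b⟩ = [posSqrtTwoTest (ival a) (ival b)]` (`0 < a + b√2`);
* membership in `FP` of each, and the length bound `length_enc_le` (`|enc a| ≤ 14B + 20` when
  all `|aᵢ| < 2^B`).

## References

* S. Arora, B. Barak, *Computational Complexity: A Modern Approach*, CUP 2009, §1.3 (closure of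
  polynomial time under composition), §0.1 (pairing).
* D. E. Knuth, *The Art of Computer Programming*, Vol. 2, 3rd ed., 1998, §4.3.1 (signed
  multiprecision arithmetic).
-/

noncomputable section

namespace Literature.Computability.QuantumComplexity

namespace ZWCode

open _root_.Computability Complexity Complexity.Brick ZW

/-! ### Four-field records -/

/-- The four-field record `⟨a, ⟨b, ⟨c, d⟩⟩⟩`. [folklore] -/
def rec4 (a b c d : List Bool) : List Bool := boolPair a (boolPair b (boolPair c d))

/-- Assembling a four-field record from field functions. [folklore] -/
def mk4 (f₀ f₁ f₂ f₃ : List Bool → List Bool) : List Bool → List Bool :=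
  fanoutFn f₀ (fanoutFn f₁ (fanoutFn f₂ f₃))

/-- `mk4` applied. [folklore] -/
@[simp] theorem mk4_apply (f₀ f₁ f₂ f₃ : List Bool → List Bool) (z : List Bool) :
    mk4 f₀ f₁ f₂ f₃ z = rec4 (f₀ z) (f₁ z) (f₂ z) (f₃ z) := by
  simp [mk4, rec4]

/-- `mk4` of `FP` functions is in `FP`. [folklore] -/
theorem mk4_mem_FP {f₀ f₁ f₂ f₃ : List Bool → List Bool} (h₀ : f₀ ∈ FP) (h₁ : f₁ ∈ FP) (h₂ : f₂ ∈ FP)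
    (h₃ : f₃ ∈ FP) : mk4 f₀ f₁ f₂ f₃ ∈ FP :=
  fanoutFn_mem_FP h₀ (fanoutFn_mem_FP h₁ (fanoutFn_mem_FP h₂ h₃))

/-- The fields of a four-field record. [folklore] -/
@[simp] theorem fields_rec4 (a b c d : List Bool) :
    nthF 0 (rec4 a b c d) = a ∧ nthF 1 (rec4 a b c d) = b ∧ nthF 2 (rec4 a b c d) = c ∧
      sndPow 2 (rec4 a b c d) = d := by
  simp [rec4, nthF, sndPow]

/-- The length of a four-field record. [folklore] -/
theorem length_rec4 (a b c d : List Bool) :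
    (rec4 a b c d).length = 2 * (a.length + b.length + c.length) + d.length + 6 := by
  simp only [rec4, length_boolPair]; ring

/-! ### The code of an amplitude and the total decoder -/

/-- **The code of `a ∈ ℤ[ω]`**: the record of the canonical difference pairs of its four
coordinates. [folklore] -/
def enc (a : ZW) : List Bool := rec4 (dpEnc (a 0)) (dpEnc (a 1)) (dpEnc (a 2)) (dpEnc (a 3))

/-- **The total decoder**: every string denotes an element of `ℤ[ω]` (fields read by `ival`).
[folklore] -/
def dec (u : List Bool) : ZW := ![ival (nthF 0 u), ival (nthF 1 u), ival (nthF 2 u), ival (sndPow 2 u)]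

/-- The coordinates of a decoded string. [folklore] -/
@[simp] theorem dec_apply (u : List Bool) :
    dec u 0 = ival (nthF 0 u) ∧ dec u 1 = ival (nthF 1 u) ∧ dec u 2 = ival (nthF 2 u) ∧
      dec u 3 = ival (sndPow 2 u) := by
  simp [dec]

/-- `dec (enc a) = a`. [folklore] -/
@[simp] theorem dec_enc (a : ZW) : dec (enc a) = a := by
  ext i
  fin_cases i <;> simp [dec, enc, rec4, nthF, sndPow]

/-- `enc` is injective. [folklore] -/
theorem enc_injective : Function.Injective enc := fun a b h => by
  have := congrArg dec h; simpa using this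

/-- Two codes with the same decoded value written from `dec` agree: `enc (dec (enc a)) = enc a`.
[folklore] -/
theorem enc_dec_enc (a : ZW) : enc (dec (enc a)) = enc a := by rw [dec_enc]

/-- **Canonicalisation**: rewrite the four fields canonically, `zwCanonF u = enc (dec u)`. [folklore] -/
def zwCanonF : List Bool → List Bool :=
  mk4 (zcanonF ∘ nthF 0) (zcanonF ∘ nthF 1) (zcanonF ∘ nthF 2) (zcanonF ∘ sndPow 2)

/-- Value of `zwCanonF` on every string. [folklore] -/
@[simp] theorem zwCanonF_apply (u : List Bool) : zwCanonF u = enc (dec u) := by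
  simp [zwCanonF, enc, dec]

/-- `zwCanonF ∈ FP`. [cite: AroraBarakCC2009, §1.3] -/
theorem zwCanonF_mem_FP : zwCanonF ∈ FP :=
  mk4_mem_FP (comp_mem_FP zcanonF_mem_FP (nthF_mem_FP 0)) (comp_mem_FP zcanonF_mem_FP (nthF_mem_FP 1))
    (comp_mem_FP zcanonF_mem_FP (nthF_mem_FP 2)) (comp_mem_FP zcanonF_mem_FP (sndPow_mem_FP 2))

/-- The code of `0`. [folklore] -/
theorem enc_zero : enc 0 = rec4 (dpEnc 0) (dpEnc 0) (dpEnc 0) (dpEnc 0) := rfl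

/-- The constant `enc 0` is in `FP`. [folklore] -/
theorem zero_mem_FP : (fun _ : List Bool => enc 0) ∈ FP := const_mem_FP _

/-! ### Addition and multiplication by powers of `ω` -/

/-- **Addition** on `⟨u, v⟩`, coordinatewise. [folklore] -/
def zwAddF : List Bool → List Bool :=
  mk4 (zaddF ∘ fanoutFn (nthF 0 ∘ fstF) (nthF 0 ∘ sndF)) (zaddF ∘ fanoutFn (nthF 1 ∘ fstF) (nthF 1 ∘ sndF))
    (zaddF ∘ fanoutFn (nthF 2 ∘ fstF) (nthF 2 ∘ sndF)) (zaddF ∘ fanoutFn (sndPow 2 ∘ fstF) (sndPow 2 ∘ sndF))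

/-- Value of `zwAddF`: `zwAddF ⟨u, v⟩ = enc (dec u + dec v)`. [folklore] -/
@[simp] theorem zwAddF_boolPair (u v : List Bool) : zwAddF (boolPair u v) = enc (dec u + dec v) := by
  simp [zwAddF, enc, dec]

/-- `zwAddF ∈ FP`. [cite: AroraBarakCC2009, §1.3] -/
theorem zwAddF_mem_FP : zwAddF ∈ FP :=
  mk4_mem_FP (comp_mem_FP zaddF_mem_FP (fanoutFn_mem_FP (comp_mem_FP (nthF_mem_FP 0) fstF_mem_FP) (comp_mem_FP (nthF_mem_FP 0) sndF_mem_FP)))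
    (comp_mem_FP zaddF_mem_FP (fanoutFn_mem_FP (comp_mem_FP (nthF_mem_FP 1) fstF_mem_FP) (comp_mem_FP (nthF_mem_FP 1) sndF_mem_FP)))
    (comp_mem_FP zaddF_mem_FP (fanoutFn_mem_FP (comp_mem_FP (nthF_mem_FP 2) fstF_mem_FP) (comp_mem_FP (nthF_mem_FP 2) sndF_mem_FP)))
    (comp_mem_FP zaddF_mem_FP (fanoutFn_mem_FP (comp_mem_FP (sndPow_mem_FP 2) fstF_mem_FP) (comp_mem_FP (sndPow_mem_FP 2) sndF_mem_FP)))

/-- **Multiplication by `ω`**: `(a₀,a₁,a₂,a₃) ↦ (−a₃,a₀,a₁,a₂)` on codes. [folklore] -/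
def mulOmegaF : List Bool → List Bool :=
  mk4 (znegF ∘ sndPow 2) (zcanonF ∘ nthF 0) (zcanonF ∘ nthF 1) (zcanonF ∘ nthF 2)

/-- Value of `mulOmegaF` on every string. [folklore] -/
@[simp] theorem mulOmegaF_apply (u : List Bool) : mulOmegaF u = enc (mulOmega (dec u)) := by
  simp [mulOmegaF, enc, dec, mulOmega]

/-- `mulOmegaF ∈ FP`. [cite: AroraBarakCC2009, §1.3] -/
theorem mulOmegaF_mem_FP : mulOmegaF ∈ FP :=
  mk4_mem_FP (comp_mem_FP znegF_mem_FP (sndPow_mem_FP 2)) (comp_mem_FP zcanonF_mem_FP (nthF_mem_FP 0))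
    (comp_mem_FP zcanonF_mem_FP (nthF_mem_FP 1)) (comp_mem_FP zcanonF_mem_FP (nthF_mem_FP 2))

/-- **Multiplication by `ω^j`**: `j` rounds of `mulOmegaF` after canonicalisation. [folklore] -/
def zwPowF : ℕ → (List Bool → List Bool)
  | 0 => zwCanonF
  | j + 1 => mulOmegaF ∘ zwPowF j

/-- Value of `zwPowF j` on every string. [folklore] -/
@[simp] theorem zwPowF_apply (j : ℕ) (u : List Bool) : zwPowF j u = enc (mulOmegaPow j (dec u)) := by
  induction j with
  | zero => simp [zwPowF, mulOmegaPow]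
  | succ j ih =>
    rw [zwPowF, Function.comp_apply, ih, mulOmegaF_apply, dec_enc, mulOmegaPow, mulOmegaPow,
      Function.iterate_succ_apply']

/-- `zwPowF j ∈ FP`. [cite: AroraBarakCC2009, §1.3] -/
theorem zwPowF_mem_FP : ∀ j : ℕ, zwPowF j ∈ FP
  | 0 => zwCanonF_mem_FP
  | j + 1 => comp_mem_FP mulOmegaF_mem_FP (zwPowF_mem_FP j)

/-- The test "the phase field is `1^k`", one bit. [folklore] -/
def phaseIs (k : ℕ) : List Bool → List Bool := eqPairFn ∘ fanoutFn fstF (fun _ => ones k)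

/-- Value of `phaseIs`. [folklore] -/
@[simp] theorem phaseIs_apply (k : ℕ) (z : List Bool) : phaseIs k z = [decide (fstF z = ones k)] := by
  simp [phaseIs, eqPairFn_boolPair]

/-- `phaseIs k ∈ FP`. [folklore] -/
theorem phaseIs_mem_FP (k : ℕ) : phaseIs k ∈ FP :=
  comp_mem_FP eqPairFn_mem_FP (fanoutFn_mem_FP fstF_mem_FP (const_mem_FP _))

/-- **Rotation by a unary phase** on `⟨ph, u⟩`: dispatch on `ph = 1^k`, `k = 0, …, 6`, with
`k = 7` as the default branch. [folklore] -/
def zwRotF : List Bool → List Bool :=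
  iteFn (phaseIs 0) (zwPowF 0 ∘ sndF) (iteFn (phaseIs 1) (zwPowF 1 ∘ sndF) (iteFn (phaseIs 2) (zwPowF 2 ∘ sndF)
    (iteFn (phaseIs 3) (zwPowF 3 ∘ sndF) (iteFn (phaseIs 4) (zwPowF 4 ∘ sndF) (iteFn (phaseIs 5) (zwPowF 5 ∘ sndF)
      (iteFn (phaseIs 6) (zwPowF 6 ∘ sndF) (zwPowF 7 ∘ sndF)))))))

/-- `zwRotF ∈ FP`. [cite: AroraBarakCC2009, §1.3] -/
theorem zwRotF_mem_FP : zwRotF ∈ FP :=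
  iteFn_mem_FP (phaseIs_mem_FP 0) (comp_mem_FP (zwPowF_mem_FP 0) sndF_mem_FP)
    (iteFn_mem_FP (phaseIs_mem_FP 1) (comp_mem_FP (zwPowF_mem_FP 1) sndF_mem_FP)
      (iteFn_mem_FP (phaseIs_mem_FP 2) (comp_mem_FP (zwPowF_mem_FP 2) sndF_mem_FP)
        (iteFn_mem_FP (phaseIs_mem_FP 3) (comp_mem_FP (zwPowF_mem_FP 3) sndF_mem_FP)
          (iteFn_mem_FP (phaseIs_mem_FP 4) (comp_mem_FP (zwPowF_mem_FP 4) sndF_mem_FP)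
            (iteFn_mem_FP (phaseIs_mem_FP 5) (comp_mem_FP (zwPowF_mem_FP 5) sndF_mem_FP)
              (iteFn_mem_FP (phaseIs_mem_FP 6) (comp_mem_FP (zwPowF_mem_FP 6) sndF_mem_FP)
                (comp_mem_FP (zwPowF_mem_FP 7) sndF_mem_FP)))))))

/-- The dispatch, given the values of the phase tests. [folklore] -/
theorem zwRotF_eq_of_tests (z : List Bool) (k : ℕ) (hk : k < 8) (hph : ∀ j, phaseIs j z = [decide (k = j)]) :
    zwRotF z = zwPowF k (sndF z) := by
  have h0 := hph 0; have h1 := hph 1; have h2 := hph 2; have h3 := hph 3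
  have h4 := hph 4; have h5 := hph 5; have h6 := hph 6
  interval_cases k <;>
    simp [zwRotF, iteFn_apply h0, iteFn_apply h1, iteFn_apply h2, iteFn_apply h3, iteFn_apply h4,
      iteFn_apply h5, iteFn_apply h6]

/-- **Value of `zwRotF`**: on a unary phase `1^k` with `k < 8`, multiplication by `ω^k`. [folklore] -/
theorem zwRotF_boolPair (k : ℕ) (hk : k < 8) (u : List Bool) :
    zwRotF (boolPair (ones k) u) = enc (mulOmegaPow k (dec u)) := by
  have hph : ∀ j, phaseIs j (boolPair (ones k) u) = [decide (k = j)] := fun j => by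
    rw [phaseIs_apply, fstF_boolPair]
    by_cases h : k = j
    · subst h; simp
    · have hne : ones k ≠ ones j := fun h' => h (by simpa [ones] using congrArg List.length h')
      rw [decide_eq_false hne, decide_eq_false h]
  rw [zwRotF_eq_of_tests _ k hk hph, sndF_boolPair, zwPowF_apply]

/-- Every output of `zwRotF` is a code. [folklore] -/
theorem zwRotF_eq_enc (z : List Bool) : ∃ j ≤ 7, zwRotF z = enc (mulOmegaPow j (dec (sndF z))) := by
  have hph : ∀ j, ∃ b : Bool, phaseIs j z = [b] := fun j => ⟨_, phaseIs_apply j z⟩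
  simp only [zwRotF]
  obtain ⟨b0, h0⟩ := hph 0; obtain ⟨b1, h1⟩ := hph 1; obtain ⟨b2, h2⟩ := hph 2; obtain ⟨b3, h3⟩ := hph 3
  obtain ⟨b4, h4⟩ := hph 4; obtain ⟨b5, h5⟩ := hph 5; obtain ⟨b6, h6⟩ := hph 6
  rw [iteFn_apply h0]
  cases b0
  · rw [if_neg (by decide), iteFn_apply h1]
    cases b1
    · rw [if_neg (by decide), iteFn_apply h2]
      cases b2
      · rw [if_neg (by decide), iteFn_apply h3]
        cases b3
        · rw [if_neg (by decide), iteFn_apply h4]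
          cases b4
          · rw [if_neg (by decide), iteFn_apply h5]
            cases b5
            · rw [if_neg (by decide), iteFn_apply h6]
              cases b6
              · rw [if_neg (by decide)]; exact ⟨7, le_rfl, by simp⟩
              · rw [if_pos rfl]; exact ⟨6, by norm_num, by simp⟩
            · rw [if_pos rfl]; exact ⟨5, by norm_num, by simp⟩
          · rw [if_pos rfl]; exact ⟨4, by norm_num, by simp⟩
        · rw [if_pos rfl]; exact ⟨3, by norm_num, by simp⟩
      · rw [if_pos rfl]; exact ⟨2, by norm_num, by simp⟩
    · rw [if_pos rfl]; exact ⟨1, by norm_num, by simp⟩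
  · rw [if_pos rfl]; exact ⟨0, by norm_num, by simp⟩

/-! ### The norm parts -/

/-- The square of field `f` as a canonical integer code. [folklore] -/
def zwSqF (f : List Bool → List Bool) : List Bool → List Bool := zmulF ∘ fanoutFn f f

/-- Value of `zwSqF`. [folklore] -/
@[simp] theorem zwSqF_apply (f : List Bool → List Bool) (u : List Bool) : zwSqF f u = dpEnc (ival (f u) * ival (f u)) := by
  simp [zwSqF]

/-- `zwSqF f ∈ FP` for `f ∈ FP`. [folklore] -/
theorem zwSqF_mem_FP {f : List Bool → List Bool} (hf : f ∈ FP) : zwSqF f ∈ FP :=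
  comp_mem_FP zmulF_mem_FP (fanoutFn_mem_FP hf hf)

/-- The product of fields `f`, `g` as a canonical integer code. [folklore] -/
def zwPrF (f g : List Bool → List Bool) : List Bool → List Bool := zmulF ∘ fanoutFn f g

/-- Value of `zwPrF`. [folklore] -/
@[simp] theorem zwPrF_apply (f g : List Bool → List Bool) (u : List Bool) :
    zwPrF f g u = dpEnc (ival (f u) * ival (g u)) := by
  simp [zwPrF]

/-- `zwPrF f g ∈ FP`. [folklore] -/
theorem zwPrF_mem_FP {f g : List Bool → List Bool} (hf : f ∈ FP) (hg : g ∈ FP) : zwPrF f g ∈ FP :=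
  comp_mem_FP zmulF_mem_FP (fanoutFn_mem_FP hf hg)

/-- **The rational part of the squared modulus**, `zwUF u = dpEnc (zwU (dec u))`. [folklore] -/
def zwUF : List Bool → List Bool :=
  zaddF ∘ fanoutFn (zaddF ∘ fanoutFn (zwSqF (nthF 0)) (zwSqF (nthF 1))) (zaddF ∘ fanoutFn (zwSqF (nthF 2)) (zwSqF (sndPow 2)))

/-- Value of `zwUF` on every string. [folklore] -/
@[simp] theorem zwUF_apply (u : List Bool) : zwUF u = dpEnc (zwU (dec u)) := by
  simp [zwUF, zwU, dec, add_assoc]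

/-- `zwUF ∈ FP`. [cite: AroraBarakCC2009, §1.3] -/
theorem zwUF_mem_FP : zwUF ∈ FP :=
  comp_mem_FP zaddF_mem_FP (fanoutFn_mem_FP
    (comp_mem_FP zaddF_mem_FP (fanoutFn_mem_FP (zwSqF_mem_FP (nthF_mem_FP 0)) (zwSqF_mem_FP (nthF_mem_FP 1))))
    (comp_mem_FP zaddF_mem_FP (fanoutFn_mem_FP (zwSqF_mem_FP (nthF_mem_FP 2)) (zwSqF_mem_FP (sndPow_mem_FP 2)))))

/-- **The `√2`-part of the squared modulus**, `zwVF u = dpEnc (zwV (dec u))`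
(`a₀a₁ + a₁a₂ + a₂a₃ − a₃a₀`). [folklore] -/
def zwVF : List Bool → List Bool :=
  zsubF ∘ fanoutFn
    (zaddF ∘ fanoutFn (zaddF ∘ fanoutFn (zwPrF (nthF 0) (nthF 1)) (zwPrF (nthF 1) (nthF 2))) (zwPrF (nthF 2) (sndPow 2)))
    (zwPrF (sndPow 2) (nthF 0))

/-- Value of `zwVF` on every string. [folklore] -/
@[simp] theorem zwVF_apply (u : List Bool) : zwVF u = dpEnc (zwV (dec u)) := by
  simp [zwVF, zwV, dec]

/-- `zwVF ∈ FP`. [cite: AroraBarakCC2009, §1.3] -/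
theorem zwVF_mem_FP : zwVF ∈ FP :=
  comp_mem_FP zsubF_mem_FP (fanoutFn_mem_FP
    (comp_mem_FP zaddF_mem_FP (fanoutFn_mem_FP
      (comp_mem_FP zaddF_mem_FP (fanoutFn_mem_FP (zwPrF_mem_FP (nthF_mem_FP 0) (nthF_mem_FP 1)) (zwPrF_mem_FP (nthF_mem_FP 1) (nthF_mem_FP 2))))
      (zwPrF_mem_FP (nthF_mem_FP 2) (sndPow_mem_FP 2))))
    (zwPrF_mem_FP (sndPow_mem_FP 2) (nthF_mem_FP 0)))

/-! ### The sign test `0 < a + b√2` -/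

/-- `[0 < a]` on the first component. [folklore] -/
def aPosT : List Bool → List Bool := iposFn ∘ fstF
/-- `[0 ≤ b]` on the second component (`¬ (0 < -b)`). [folklore] -/
def bNonnegT : List Bool → List Bool := notFn (iposFn ∘ zswapF ∘ sndF)
/-- The code of `a²`. [folklore] -/
def aSqF : List Bool → List Bool := zwSqF fstF
/-- The code of `2b²`. [folklore] -/
def twoBSqF : List Bool → List Bool := zaddF ∘ fanoutFn (zwSqF sndF) (zwSqF sndF)
/-- `[2b² < a²]` (`¬ (a² ≤ 2b²)`). [folklore] -/
def ltT₁ : List Bool → List Bool := notFn (zleF ∘ fanoutFn aSqF twoBSqF)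
/-- `[a² < 2b²]` (`¬ (2b² ≤ a²)`). [folklore] -/
def ltT₂ : List Bool → List Bool := notFn (zleF ∘ fanoutFn twoBSqF aSqF)

/-- **The exact sign test** `posTestF ⟨a, b⟩ = [posSqrtTwoTest (ival a) (ival b)]`
(`StateVectorDP.posSqrtTwoTest`: `0 < a + b√2`). [folklore] -/
def posTestF : List Bool → List Bool :=
  orFn (andFn aPosT (orFn bNonnegT ltT₁)) (andFn (notFn aPosT) (andFn bNonnegT ltT₂))

/-- Value of `aPosT`. [folklore] -/
theorem aPosT_apply (z : List Bool) : aPosT z = [decide (0 < ival (fstF z))] := by simp [aPosT]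

/-- Value of `bNonnegT`. [folklore] -/
theorem bNonnegT_apply (z : List Bool) : bNonnegT z = [decide (0 ≤ ival (sndF z))] := by
  rw [bNonnegT, notFn_apply (b := decide (0 < -ival (sndF z))) (by simp)]
  congr 1
  by_cases h : 0 ≤ ival (sndF z)
  · rw [decide_eq_true h, decide_eq_false (by omega)]; rfl
  · rw [decide_eq_false h, decide_eq_true (by omega)]; rfl

/-- Value of `ltT₁`. [folklore] -/
theorem ltT₁_apply (z : List Bool) :
    ltT₁ z = [decide (2 * ival (sndF z) * ival (sndF z) < ival (fstF z) * ival (fstF z))] := by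
  have h : (zleF ∘ fanoutFn aSqF twoBSqF) z =
      [decide (ival (fstF z) * ival (fstF z) ≤ 2 * ival (sndF z) * ival (sndF z))] := by
    simp [aSqF, twoBSqF, two_mul, add_mul]
  rw [ltT₁, notFn_apply h]
  congr 1
  by_cases hc : ival (fstF z) * ival (fstF z) ≤ 2 * ival (sndF z) * ival (sndF z)
  · rw [decide_eq_true hc, decide_eq_false (not_lt.2 hc)]; rfl
  · rw [decide_eq_false hc, decide_eq_true (not_le.1 hc)]; rfl

/-- Value of `ltT₂`. [folklore] -/
theorem ltT₂_apply (z : List Bool) :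
    ltT₂ z = [decide (ival (fstF z) * ival (fstF z) < 2 * ival (sndF z) * ival (sndF z))] := by
  have h : (zleF ∘ fanoutFn twoBSqF aSqF) z =
      [decide (2 * ival (sndF z) * ival (sndF z) ≤ ival (fstF z) * ival (fstF z))] := by
    simp [aSqF, twoBSqF, two_mul, add_mul]
  rw [ltT₂, notFn_apply h]
  congr 1
  by_cases hc : 2 * ival (sndF z) * ival (sndF z) ≤ ival (fstF z) * ival (fstF z)
  · rw [decide_eq_true hc, decide_eq_false (not_lt.2 hc)]; rfl
  · rw [decide_eq_false hc, decide_eq_true (not_le.1 hc)]; rfl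

/-- **Value of the sign test on every string.** [folklore] -/
theorem posTestF_apply (z : List Bool) : posTestF z = [posSqrtTwoTest (ival (fstF z)) (ival (sndF z))] := by
  rw [posTestF, orFn_apply (andFn_apply (aPosT_apply z) (orFn_apply (bNonnegT_apply z) (ltT₁_apply z)))
    (andFn_apply (notFn_apply (aPosT_apply z)) (andFn_apply (bNonnegT_apply z) (ltT₂_apply z)))]
  simp only [posSqrtTwoTest]
  congr 1
  by_cases h : 0 < ival (fstF z)
  · simp [h, not_le.2 h]
  · simp [h, not_lt.1 h]

/-- Value of the sign test on a pair. [folklore] -/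
theorem posTestF_boolPair (a b : List Bool) : posTestF (boolPair a b) = [posSqrtTwoTest (ival a) (ival b)] := by
  rw [posTestF_apply, fstF_boolPair, sndF_boolPair]

/-- The sign test is one-bit. [folklore] -/
theorem oneBit_posTestF : OneBit posTestF := fun z => ⟨_, posTestF_apply z⟩

/-- `posTestF ∈ FP`. [cite: AroraBarakCC2009, §1.3] -/
theorem posTestF_mem_FP : posTestF ∈ FP := by
  have haPos : aPosT ∈ FP := comp_mem_FP iposFn_mem_FP fstF_mem_FP
  have hb : bNonnegT ∈ FP := notFn_mem_FP (comp_mem_FP iposFn_mem_FP (comp_mem_FP zswapF_mem_FP sndF_mem_FP))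
  have hsq : aSqF ∈ FP := zwSqF_mem_FP fstF_mem_FP
  have h2b : twoBSqF ∈ FP := comp_mem_FP zaddF_mem_FP (fanoutFn_mem_FP (zwSqF_mem_FP sndF_mem_FP) (zwSqF_mem_FP sndF_mem_FP))
  have h1 : ltT₁ ∈ FP := notFn_mem_FP (comp_mem_FP zleF_mem_FP (fanoutFn_mem_FP hsq h2b))
  have h2 : ltT₂ ∈ FP := notFn_mem_FP (comp_mem_FP zleF_mem_FP (fanoutFn_mem_FP h2b hsq))
  exact orFn_mem_FP (andFn_mem_FP haPos (orFn_mem_FP hb h1)) (andFn_mem_FP (notFn_mem_FP haPos) (andFn_mem_FP hb h2))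

/-! ### Lengths -/

/-- A canonical integer code of a value of modulus `< 2^B` has at most `2B + 2` symbols.
[folklore] -/
theorem length_dpEnc_le_of_lt {z : ℤ} {B : ℕ} (h : z.natAbs < 2 ^ B) : (dpEnc z).length ≤ 2 * B + 2 :=
  (length_dpEnc_le_two_mul z).trans (by have := (length_encodeNat_le_iff _ B).2 h; omega)

/-- **The length of an amplitude code**: `≤ 14B + 20` when all coordinates have modulus `< 2^B`.
[folklore] -/
theorem length_enc_le {a : ZW} {B : ℕ} (h : ∀ i, (a i).natAbs < 2 ^ B) : (enc a).length ≤ 14 * B + 20 := by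
  rw [enc, length_rec4]
  have h0 := length_dpEnc_le_of_lt (h 0)
  have h1 := length_dpEnc_le_of_lt (h 1)
  have h2 := length_dpEnc_le_of_lt (h 2)
  have h3 := length_dpEnc_le_of_lt (h 3)
  omega

end ZWCode

end Literature.Computability.QuantumComplexity

end
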